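import Literature.MathematicalPhysics.QuantumFieldTheory.Balaban1983to89.B1Prop22ZeroFieldTorus

/-!
# `Balaban1983to89.B1Prop22ZeroFieldTorusFam` — T. Bałaban, *(Higgs)₂,₃ quantum fields in a finite volume. I. A lower bound*, Commun. Math.
# Phys. **85** (1982) 603–626 [Balaban1982Higgs1]: the TYPED Proposition 2.2 (`B1.Prop22Literal` / `B1.Prop22Small`, (2.27)–(2.29) p. 611)
# INHABITED by the ZERO-FIELD TORUS FAMILY of Bałaban's concrete scalar tower (`Ω = Ω₀ = T_ε`, top level, every volume, every `m² ≥ 0`)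

statement-level skeleton of published theorems with citation tags; proofs where landed; nothing here is a claim about the Yang–Mills mass gap

PDF held: `paper:balaban1982-cmp85-higgs23-i` (journal page = PDF page + 602), p. 611 [PDF 9]; read by this seat.

CITATION HEADER (lean-in-tree rule).  Cell `lit-balaban` (HOME `run/shared/lean/pub/lit-balaban/`), Phase-2 proof seat **p14** gen 10 (unit
`lit-balaban-p14`); SKELETON row **B1.Prop2.2** (decls of record `B1.Prop22Literal` / `B1.Prop22Small` over pv07's carrier `B1.DeltaSetting`,
owners r01/r14).  The definition-lane sequel of this seat's `B1Prop22ZeroFieldTorus` (the kernel bound `prop22_kernel_zeroField_torus`):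
here only the `B1.DeltaSetting`-valued family and the two typed claims.  Siblings: p17's `B1Prop22Proof.zeroDelta` / `prop22Literal_zeroField`
(nested finite REGIONS of `ℤ^{d+1}`), `B1Prop22RegularField` (`A ≠ 0`).  USED BY NAME, never restated: p38's index `B4ThmZeroTorusEta.TorusEtaIdx`
(volume `(d, L, m, K)`, `K ≥ 1`, charge `e`), `B1RG242.StepData.Δk` of `B1RG242Torus.tower`, `B5Ineq137Torus.T`, `B1.{DeltaSetting, Prop22Literal,
Prop22Small, prop22Small_of_literal}`.

WHAT IS PRINTED (verbatim, I p. 611 [PDF 9]).  *"Proposition 2.2. If a configuration A is regular in the same sense as in Proposition 2.1 then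
there exist constants δ₀ > 0 and c₀, depending on the same quantities as in Proposition 2.1, such that |Δ^{(k)}(Ω,A;x,x′)| ≤ c₀exp(−δ₀|x−x′|),
x,x′ ∈ Ω^{(k)}. (2.27) Putting for Ω ⊂ Ω₀  δΔ^{(k)}(Ω,Ω₀,A) = Δ^{(k)}(Ω,A) − Δ^{(k)}(Ω₀,A), (2.28) the following inequality holds
|δΔ^{(k)}(Ω,Ω₀,A;x,x′)| ≤ c₀ exp(−δ₀(|x−x′| + dist(x,Ω^{(k)c}) + dist(x′,Ω^{(k)c}))). (2.29)"*

WHAT THIS FILE PROVES (kernel-checked, zero `sorry`; one definition with body, theorems; axioms standard).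
* `zeroDeltaTorus d L a m² i` — the `B1.DeltaSetting` of the member `i = (P, e)`: `KSite := Site P K` (the unit lattice `T^{(K)} = Ω^{(K)}`),
  `e := i.e`, `regular := True` (`A = 0`), `bigBlocks := True` (`Ω^{(K)} = T^{(K)}`), `udist := |y − y′|_{T^{(K)}}` (`B5Ineq137Torus.T P K`),
  `distOc := 0` (`Ω^{(K)c} = ∅`), `kerD y y′ := |Δ^{(K)}(T_ε,0; y,y′)|` (the tower's `StepData.Δk` at the top level), `kerDD0 y y′ :=
  |Δ^{(K)}(T_ε,0;y,y′) − Δ^{(K)}(T_ε,0;y,y′)|` ((2.28) with `Ω = Ω₀ = T_ε`); readings `zeroDeltaTorus_kerD`, `zeroDeltaTorus_kerDD0` (`= 0`).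
* **`prop22Literal_zeroField_torus`**: for `L > 1`, `a > 0`, `m² ≥ 0`, every `d`: `B1.Prop22Literal (zeroDeltaTorus d L a m²)` — (2.27) from
  `prop22_kernel_zeroField_torus`, (2.29) trivially (`δΔ = 0`); **`prop22Small_zeroField_torus`**: the intended reading (`B1.prop22Small_of_literal`).
* `zeroDeltaTorus_nonempty`: the family is inhabited (p38's `torusEtaIdx_nonempty'`).
HONEST SCOPE.  `A = 0`, `U ≡ 1`, one component, `Ω = Ω₀ = T_ε` only ((2.29) is moot), top level `k = K` of each volume, sup torus distance of
`T^{(K)}`; constants existential (functions of `d, L, a`); nothing here is summit progress.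
-/

namespace Literature.MathematicalPhysics.QuantumFieldTheory.Balaban1983to89

open Matrix Finset

noncomputable section

namespace B1Prop22ZeroFieldTorusFam

open B1RG242Torus B5Ineq137Torus B4ThmZeroTorusEta B1Prop22ZeroFieldTorus

/-- **The zero-field torus carrier of Prop. 2.2**: member `i = (P = (d, L, m, K), e)`, `Ω = Ω₀ = T_ε`, `Ω^{(K)} = T^{(K)} = Site P K`,
`kerD y y′ = |Δ^{(K)}(T_ε, 0; y, y′)|` (the tower's `Δ^{(K)} = a_K·1 − a_K²·Q_KG^ε_KQ_K^*`, (2.21)), `kerDD0` the (2.28) difference (here `0`),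
`udist = |y − y′|_{T^{(K)}}`, `distOc = 0`, `regular = bigBlocks = True`. [cite: Balaban1982Higgs1, Prop. 2.2 (2.27)–(2.29) p.611, (2.21) p.610] -/
def zeroDeltaTorus (d L : ℕ) (a msq : ℝ) (i : TorusEtaIdx d L) : B1.DeltaSetting where
  KSite := Site i.P i.P.K
  e := i.e
  regular := True
  bigBlocks := True
  udist := fun y y' => T i.P i.P.K y y'
  distOc := fun _ => 0
  kerD := fun y y' => |((tower i.P a msq).step i.P.K).Δk y y'|
  kerDD0 := fun y y' => |((tower i.P a msq).step i.P.K).Δk y y' - ((tower i.P a msq).step i.P.K).Δk y y'|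

/-- Reading: the (2.27) kernel of the member. [cite: Balaban1982Higgs1, (2.27) p.611; bookkeeping] -/
theorem zeroDeltaTorus_kerD (d L : ℕ) (a msq : ℝ) (i : TorusEtaIdx d L) (y y' : Site i.P i.P.K) :
    (zeroDeltaTorus d L a msq i).kerD y y' = |((tower i.P a msq).step i.P.K).Δk y y'| := rfl

/-- Reading: the (2.28) kernel of the member vanishes (`Ω = Ω₀`). [cite: Balaban1982Higgs1, (2.28) p.611; bookkeeping] -/
theorem zeroDeltaTorus_kerDD0 (d L : ℕ) (a msq : ℝ) (i : TorusEtaIdx d L) (y y' : Site i.P i.P.K) :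
    (zeroDeltaTorus d L a msq i).kerDD0 y y' = 0 := by
  show |_ - _| = 0
  rw [sub_self, abs_zero]

/-- The printed hypotheses of the member hold (`regular`, `bigBlocks`). [cite: Balaban1982Higgs1, Prop. 2.2 p.611; bookkeeping] -/
theorem zeroDeltaTorus_hyps (d L : ℕ) (a msq : ℝ) (i : TorusEtaIdx d L) :
    (zeroDeltaTorus d L a msq i).regular ∧ (zeroDeltaTorus d L a msq i).bigBlocks := ⟨trivial, trivial⟩

/-- NON-VACUITY: `d ≥ 1`, odd `L > 1`, any `m`, `K ≥ 1`, any charge give a member. [cite: Balaban1982Higgs1, p.604 (the torus); non-vacuity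
bookkeeping] -/
theorem zeroDeltaTorus_nonempty (d L m K : ℕ) (hd : 1 ≤ d) (hL : Odd L ∧ 1 < L) (hK : 1 ≤ K) (e : ℝ) :
    Nonempty (TorusEtaIdx d L) := torusEtaIdx_nonempty' d L m K hd hL hK e

/-- **PROPOSITION 2.2, LITERAL READING, FOR THE ZERO-FIELD TORUS FAMILY**: for `L > 1`, `a > 0`, `m² ≥ 0` and every `d` there are
`δ₀, c₀ > 0` such that for EVERY member (every volume `(d, L, m, K)`, `K ≥ 1`, every charge): `|Δ^{(K)}(T_ε,0; y,y′)| ≤ c₀e^{−δ₀|y−y′|}` ((2.27),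
`prop22_kernel_zeroField_torus`) and the (2.29) clause (trivially: `δΔ^{(K)}(T_ε,T_ε,0) = 0`). [cite: Balaban1982Higgs1, Prop. 2.2 (2.27)–(2.29)
p.611] -/
theorem prop22Literal_zeroField_torus (d L : ℕ) (hL : 1 < L) {a : ℝ} (ha : 0 < a) {msq : ℝ} (hm : 0 ≤ msq) :
    B1.Prop22Literal (zeroDeltaTorus d L a msq) := by
  obtain ⟨δ₀, c₀, hδ₀, hc₀, h⟩ := prop22_kernel_zeroField_torus d L hL ha
  refine ⟨δ₀, c₀, hδ₀, hc₀, fun i _ _ => ⟨fun y y' => h i.P i.hPd i.hPL msq hm i.hK y y', fun y y' => ?_⟩⟩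
  rw [zeroDeltaTorus_kerDD0]
  positivity

/-- **PROPOSITION 2.2, INTENDED READING** (threshold inherited from Prop. 2.1; idle at `A = 0`) for the zero-field torus family.
[cite: Balaban1982Higgs1, Prop. 2.2 p.611 with Prop. 2.1 p.610] -/
theorem prop22Small_zeroField_torus (d L : ℕ) (hL : 1 < L) {a : ℝ} (ha : 0 < a) {msq : ℝ} (hm : 0 ≤ msq) :
    B1.Prop22Small (zeroDeltaTorus d L a msq) :=
  B1.prop22Small_of_literal _ (prop22Literal_zeroField_torus d L hL ha hm)

end B1Prop22ZeroFieldTorusFam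

end

end Literature.MathematicalPhysics.QuantumFieldTheory.Balaban1983to89
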